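import Mathlib
import HarnessLib
import Summits.NavierStokesRegularity.NavierStokesRegularity.Theorems.TaylorModelRungThreeCertificateReadoutVInterpWin

/-!
# Crux K1b-DR (stmt-NavierStokesRegularity-23954), line `taylor-model` — v3 WINDOWED read-outs: DIAGNOSTICS for the replay driver
# (ns-tm-g4 g6; computable defs only — nothing here enters a proof)

The windowed read-out Boolean of a stage is ONE conjunction of nine sub-tests (`readoutStepWin`).  For the first windowed replays
the driver (engine-1's `readoutW` mode) wants to know WHICH sub-test fails and by how much; this module exposes, in the landed
computable style (extractable verbatim into the native twin):

* `CertTables.readoutStepWinDiag rw : Array Bool` — the nine sub-tests in the order of `readoutStepWin.ok`: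
  `#[winOK, testR5 (nodes), testR7 (fat Y1), testR5 (Z1a,Z1b), testR5 (Z0a,Z0b), testR8 (Z1), landOK (Z0), testR9 (landBox Z0), testR11 (Z1)]`
  (so `ok = d[0] && d[1] && … && d[8]`);
* `CertTables.readoutStepWinNums rw : Array IntervalD` — the numbers behind the window tests:
  `#[σ·Z1a, σ·Z1b, σ·Z0a, σ·Z0b, LB (lev box), Z1[idx i₀ 1] (the y(i₀,1) range (R8) compares with as), ASB (as box)]`;
* `CertTablesV.checkReadoutStageWinDiag' / …Nums'` — the same per stage `j` of a certificate, CHECKPOINT form (`roInWin'`).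

HONEST FRAMING: replay instrumentation for the MODEL certificate №23954 (rung TL-M3); nothing here is a statement about the
Navier–Stokes equations, and nothing is asserted.
-/

-- the sub-problem namespace repeats the summit name by design (D-0017)
set_option linter.dupNamespace false

namespace Summit.NavierStokesRegularity.NavierStokesRegularity.Theorems.TaylorModelCert

namespace CertTables

variable {K : Type} [Field K]

/-- **The nine sub-tests of `readoutStepWin`** as a Boolean vector (order of the conjunction). [folklore] -/
def readoutStepWinDiag (T : CertTables K) (rw : ROInWin) : Array Bool :=
  let ri := rw.base
  #[winOK rw.u0lo rw.u0hi rw.u1lo rw.u1hi ri.h,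
    T.testR5 ri.prec ri.Wσ ri.LB ri.H1 ri.Ha1,
    T.testR7 ri.coefB ri.prec ri.mt ri.Wσ ri.GB (ri.Y1 T),
    T.testR5 ri.prec ri.Wσ ri.LB (rw.Z1a T) (rw.Z1b T),
    T.testR5 ri.prec ri.Wσ ri.LB (rw.Z0a T) (rw.Z0b T),
    T.testR8 ri.ASB ri.AK ri.rlo (rw.Z1 T),
    T.landOK (rw.Z0 T),
    T.testR9 ri.prec ri.nF ri.WJ (T.landBox ri.prec ri.LvB ri.tv (rw.Z0 T)) ri.ctrB ri.βB ri.sB ri.radB,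
    T.testR11 ri.prec ri.nF ri.WJ ri.G ri.rPB ri.βB ri.ρ ri.LvB ri.tv (rw.Z1 T) ri.Wσ (rw.Fw T) (rw.VBw T)]

/-- **The numbers behind the window tests**: the section functional's interval over the four window-end boxes, the `lev` box,
the `y(i₀,1)` interval over `Z1`, and the `as` box. [folklore] -/
def readoutStepWinNums (T : CertTables K) (rw : ROInWin) : Array IntervalD :=
  let ri := rw.base
  #[IntervalD.dotR ri.prec T.n ri.Wσ (rw.Z1a T), IntervalD.dotR ri.prec T.n ri.Wσ (rw.Z1b T),
    IntervalD.dotR ri.prec T.n ri.Wσ (rw.Z0a T), IntervalD.dotR ri.prec T.n ri.Wσ (rw.Z0b T),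
    ri.LB, IntervalD.aget (rw.Z1 T) (T.idx T.i₀ 1), ri.ASB]

end CertTables

namespace CertTablesV

variable (TV : CertTablesV) (kitOf : ℕ → CoreKit) (wT : ℕ → Array Dyad) (A : ReadoutAux QS2) (WV : WindowsV)

/-- Per-stage diagnostic Boolean vector of the windowed read-out step (checkpoint form). [folklore] -/
def checkReadoutStageWinDiag' (j : ℕ) : Array Bool := TV.base.readoutStepWinDiag (TV.roInWin' kitOf wT A WV j)

/-- Per-stage diagnostic numbers of the windowed read-out step (checkpoint form). [folklore] -/
def checkReadoutStageWinNums' (j : ℕ) : Array IntervalD := TV.base.readoutStepWinNums (TV.roInWin' kitOf wT A WV j)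

end CertTablesV

end Summit.NavierStokesRegularity.NavierStokesRegularity.Theorems.TaylorModelCert
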